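import Summits.BirchSwinnertonDyer.BirchSwinnertonDyer.Theorems.QuadraticBranchSignedControlPlusEtaNonsurjTamagawaSplit
import Summits.BirchSwinnertonDyer.Rank1Residual.Additive.TwistRamTransport
import Literature.NumberTheory.EllipticCurves.PastenValuationProductThm115Proofs
import Literature.NumberTheory.EllipticCurves.TamagawaNeZeroProofs
import HarnessLib

/-!
# Route `QuadraticBranchSignedControl` (rung K8, cell `bsd-potss`): crux stmt-BirchSwinnertonDyer-19606
# `PlusEtaMainConjectureNonsurj` — THE TAMAGAWA LAW ON THE ADDITIVE PARTNER: for a row `V = W ⊗ χ_{p*}` and every split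
# multiplicative place `v ∤ p` of the PARTNER `W`, `p ∣ c_v(W)` (the `η`-branch half of the class-wide θ₀-census of
# FINDING-19606-k8eta-c2-g11 §2d: `v₅(√5·L(W,1)/Ω_V) = v₅(Tam W)` in 94/95 rank-0 partners of the height-20 table, the 95th having
# `25 ∣ #Ш(W)_an` on top)

WHAT. Companion of `…PlusEtaNonsurjTamagawaSplit` (p586144: `p ∣ c_v(V)` at the split multiplicative places `v ∤ p` of a ROW `V`).
The crux's rows come as pairs `C • W^{(p*)} = V` (`p* = (−1)^{(p−1)/2} p`, the crux's `(-1) ^ (p / 2) * p`), `W` the additive partner whose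
`L(W,1)` is interpolated by the `η`-branch of `L_p⁺(V)`. The twist by `p* ≡ 1 (mod 4)` is unramified at every prime `ℓ ≠ p`, so `W` and `V`
have the same multiplicative primes `ℓ ≠ p` and the same `v_ℓ(Δ_min)` there (residual cell, additive-p4:
`Additive.mult_iff_of_twist_pStar`, `Additive.padicValInt_minimalDiscriminantInt_eq_of_twist_pStar`); on the row `V`,
`p ∣ v_ℓ(Δ_min(V))` (k8eta-c2 g9 p571941); and at a split multiplicative place `c_v(W) = ord_v Δ_min(W)` (Kodaira–Néron, tree theorem
`localTamagawaNumber_eq_ordMinimalDiscriminant_of_hasSplitMultiplicativeReductionAt`). Hence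
`dvd_localTamagawaNumber_partner_of_hasSplitMultiplicativeReductionAt_of_row`: **`p ∣ c_v(W)`**.

HONEST FRAMING (cell `bsd-potss`, run/shared/lean/pub/bsd-potss/; FULL-BSD rank ≤ 1 programme): TOOL THEOREM ONLY (no definition, no named
fact, no `sorry`, axioms standard). Nothing is booked; crux 19606 stays OPEN; `BSD(W, p)` is claimed for no pair. Seat `bsd-potss-k8eta-c2` g11
(prover), `--supports stmt-BirchSwinnertonDyer-19606`.

References: [SilvermanATAEC1994] Cor. IV.9.2 (d), IV.9.4; [SilvermanAEC2009] VII.1 Prop. 1.3; [Serre1972] §2.2.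
-/

set_option autoImplicit false
set_option linter.dupNamespace false

noncomputable section

open scoped Classical NumberField

open NumberField IsDedekindDomain Field WeierstrassCurve Literature.NumberTheory.EllipticCurves
  Literature.NumberTheory.EllipticCurves.Rank1Residual Rat.HeightOneSpectrum
  Summit.BirchSwinnertonDyer.Rank1Residual.Additive

namespace Summit.BirchSwinnertonDyer.BirchSwinnertonDyer.Theorems.EtaCartanField

/-- The crux's twist parameter `p* = (−1)^{⌊p/2⌋}·p` of an odd prime `p` is `±p` and `≡ 1 (mod 4)`: there is `k ∈ ℤ` with
`p* = 4k + 1`, and `((p* : ℤ) : ℚ) = (−1)^{⌊p/2⌋}·p` in `ℚ`. [folklore] -/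
theorem exists_pStar_eq (p : ℕ) [hp : Fact p.Prime] (hp2 : p ≠ 2) :
    ∃ d k : ℤ, d = 4 * k + 1 ∧ (d = p ∨ d = -p) ∧ (d : ℚ) = (-1 : ℚ) ^ (p / 2) * p := by
  have hodd : p % 2 = 1 := Nat.odd_iff.mp (hp.out.odd_of_ne_two hp2)
  rcases Nat.even_or_odd (p / 2) with ⟨m, hm⟩ | ⟨m, hm⟩
  · -- `p/2 = 2m`, `p = 4m + 1`, `p* = p`
    refine ⟨p, m, ?_, Or.inl rfl, ?_⟩
    · have : (p : ℤ) = 2 * (p / 2 : ℕ) + 1 := by omega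
      rw [this, hm]; push_cast; ring
    · have he : Even (p / 2) := ⟨m, hm⟩
      rw [he.neg_one_pow, one_mul]; norm_cast
  · -- `p/2 = 2m + 1`, `p = 4m + 3`, `p* = -p = 4(-m-1) + 1`
    refine ⟨-p, -m - 1, ?_, Or.inr rfl, ?_⟩
    · have : (p : ℤ) = 2 * (p / 2 : ℕ) + 1 := by omega
      rw [this, hm]; push_cast; ring
    · have ho : Odd (p / 2) := ⟨m, hm⟩
      rw [ho.neg_one_pow]; push_cast; ring

/-- **Tamagawa law on the additive partner.** Let `V/ℚ` be a row of crux 19606 (globally minimal, `p ≥ 5` good with `a_p = 0`, `p`-adic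
tower NOT onto) written as the `p*`-twist of its additive partner, `C • W^{(p*)} = V` with `W` globally minimal (`p* = (−1)^{⌊p/2⌋} p`, the
crux's parameter). Then at every finite place `v ∤ p` at which `W` has SPLIT multiplicative reduction, `p ∣ c_v(W) = [W(ℚ_v) : W₀(ℚ_v)]`:
`c_v(W) = ord_v Δ_min(W)` (Kodaira–Néron) `= ord_v Δ_min(V)` (unramified twist), `V` is multiplicative at `v` (same), and `p ∣ ord_v Δ_min(V)`
(`ρ̄_{V,p}` unramified at `v`: no transvection on an `X_ns⁺(p)` row). [cite: SilvermanATAEC1994, Cor. IV.9.2 (d)] [cite: Serre1972, §2.2] -/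
theorem dvd_localTamagawaNumber_partner_of_hasSplitMultiplicativeReductionAt_of_row (V : WeierstrassCurve ℚ) [V.IsElliptic]
    [V.IsGloballyMinimal] (W : WeierstrassCurve ℚ) [W.IsElliptic] [W.IsGloballyMinimal] (C : VariableChange ℚ) (p : ℕ)
    [Fact p.Prime] (hp5 : 5 ≤ p) (hVW : C • W.quadraticTwist ((-1) ^ (p / 2) * p) = V) (hgood : V.HasGoodReductionAtPrime p)
    (hap : V.frobeniusTrace p = 0) (hns : ¬ ∀ m : ℕ, V.HasSurjectiveModNGaloisRep (p ^ m : ℕ)) (v : HeightOneSpectrum (𝓞 ℚ))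
    (hvp : (primesEquiv v : ℕ) ≠ p) (hs : W.HasSplitMultiplicativeReductionAt v) :
    p ∣ (W.baseChange (v.adicCompletion ℚ)).localTamagawaNumber (v.adicCompletionIntegers ℚ) := by
  haveI hℓ : Fact (primesEquiv v : ℕ).Prime := ⟨(primesEquiv v).2⟩
  obtain ⟨d, k, hdk, hdp, hdq⟩ := exists_pStar_eq p (by omega)
  have hVW' : C • W.quadraticTwist (d : ℚ) = V := by rw [hdq]; exact hVW
  -- `c_v(W) = ord_v Δ_min(W) = v_ℓ(Δ_min(W)) = v_ℓ(Δ_min(V))`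
  rw [localTamagawaNumber_eq_ordMinimalDiscriminant_of_hasSplitMultiplicativeReductionAt v W hs,
    LocalTorsionMult.ordMinimalDiscriminant_eq_padicValInt W v (q := (primesEquiv v : ℕ)) rfl,
    ← padicValInt_minimalDiscriminantInt_eq_of_twist_pStar p W hdk hdp C hVW' hvp]
  -- `W` multiplicative at `ℓ` ⟹ `V` multiplicative at `ℓ`
  have hmultW : Mult W (primesEquiv v : ℕ) :=
    (hasMultiplicativeReductionAtPrime_iff_hasMultiplicativeReductionAt_ringOfIntegers W v).mpr hs.hasMultiplicativeReductionAt
  have hmultV : Mult V (primesEquiv v : ℕ) := (mult_iff_of_twist_pStar p W hdk hdp C hVW' hvp).mpr hmultW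
  exact dvd_padicValInt_minimalDiscriminant_of_hasMultiplicativeReduction_of_row V p hp5 hgood hap hns
    (primesEquiv v : ℕ) hvp hmultV

/-- **The Tamagawa law on the partner is an EQUIVALENCE: `p ∣ c_v(W)` iff `W` has SPLIT multiplicative reduction at `v`** (`v ∤ p`; `W` the
globally minimal additive partner of a row `V = C • W^{(p*)}` of crux 19606). `⇒` by Kodaira–Néron: `c_v ≤ 4 < p` off the split multiplicative
places (`localTamagawaNumber_le_four_of_not_hasSplitMultiplicativeReduction`, `c_v ≠ 0`). FINDING-19606-k8eta-c2-g11 §2d (η-branch: the 31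
non-unit rank-0 partners of the height-20 table are the partners with a split multiplicative prime). Appended by seat `bsd-potss-k8eta-c2` g12.
[cite: SilvermanATAEC1994, Cor. IV.9.2 (d)] [cite: Serre1972, §2.2] -/
theorem dvd_localTamagawaNumber_partner_iff_hasSplitMultiplicativeReductionAt_of_row (V : WeierstrassCurve ℚ) [V.IsElliptic]
    [V.IsGloballyMinimal] (W : WeierstrassCurve ℚ) [W.IsElliptic] [W.IsGloballyMinimal] (C : VariableChange ℚ) (p : ℕ)
    [Fact p.Prime] (hp5 : 5 ≤ p) (hVW : C • W.quadraticTwist ((-1) ^ (p / 2) * p) = V) (hgood : V.HasGoodReductionAtPrime p)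
    (hap : V.frobeniusTrace p = 0) (hns : ¬ ∀ m : ℕ, V.HasSurjectiveModNGaloisRep (p ^ m : ℕ)) (v : HeightOneSpectrum (𝓞 ℚ))
    (hvp : (primesEquiv v : ℕ) ≠ p) :
    p ∣ (W.baseChange (v.adicCompletion ℚ)).localTamagawaNumber (v.adicCompletionIntegers ℚ) ↔
      W.HasSplitMultiplicativeReductionAt v := by
  refine ⟨fun h => ?_,
    dvd_localTamagawaNumber_partner_of_hasSplitMultiplicativeReductionAt_of_row V W C p hp5 hVW hgood hap hns v hvp⟩
  by_contra hs
  have h4 : (W.baseChange (v.adicCompletion ℚ)).localTamagawaNumber (v.adicCompletionIntegers ℚ) ≤ 4 :=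
    localTamagawaNumber_le_four_of_not_hasSplitMultiplicativeReduction (v.adicCompletionIntegers ℚ)
      (W.baseChange (v.adicCompletion ℚ)) hs
  have h0 : (W.baseChange (v.adicCompletion ℚ)).localTamagawaNumber (v.adicCompletionIntegers ℚ) ≠ 0 :=
    localTamagawaNumber_ne_zero_holds (v.adicCompletionIntegers ℚ) (W.baseChange (v.adicCompletion ℚ))
  have := Nat.le_of_dvd (Nat.pos_of_ne_zero h0) h
  omega

end Summit.BirchSwinnertonDyer.BirchSwinnertonDyer.Theorems.EtaCartanField

end
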